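import Mathlib
import HarnessLib
import Summits.Ventures.LatticeQCDFlow.Exactness.SUNLeapfrogHMCErgodic
import Summits.Ventures.LatticeQCDFlow.Exactness.SUNKickCoordinates

/-!
# The engine's single-step `SU(N)` HMC is uniformly ergodic: the kinetic term `−Σ tr P²` in the engine's coordinates has a finite Gaussian normalisation

HONEST FRAMING: exact (Metropolis-corrected) sampling algorithms for lattice gauge theory;
figures of merit are autocorrelation/cost numbers at stated couplings and volumes; no
continuum-physics claim.

Venture `LatticeQCDFlow` (cell pub-lqcd), topic `Exactness`, FANOUT row 9 (eng-latcore, the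
engine `latflow.core.hmc.HMC(f, β, 'leapfrog')` (4D) and `sun_2d.HMC2D` (2D) on `SU(N)`,
`trajectory(τ, nstep = 1)`: momenta `P = i(H − tr H/N)` with Gaussian Hermitian `H`
(`sun.random_algebra`: density `∝ e^{tr P²}`), kinetic term `−tr P²`, `U ← expm(εP) U`).  NEW WORK of
the cell over the tree (`SUNLeapfrogHMCErgodic.lean`: uniform ergodicity for any coordinates, any
additive Haar measure, any kinetic term `T ≥ 0` bounded on boxes with `Z_T < ∞`;
`SUNKickCoordinates.lean`: the engine's coordinates `sunCoordι` of `𝔰𝔲(N)` — injective, onto;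
Mathlib's `finite_integral_one_add_norm` and `Real.pow_div_factorial_le_exp` for the Gaussian tail);
nothing here is cited as a fact.

In the engine's coordinates `c = (d, R, I)` (zero-sum diagonal, upper real and imaginary parts) the
kinetic term of one link is the quadratic form `q(c) = Σ_i d_i² + 2 Σ_{i<j} (R_ij² + I_ij²)`
(`= −tr P²` for `P = ι c`; the identification is the definition of the coordinates and is not
re-derived here), and the momentum refresh law is `Z⁻¹ e^{−Σ_l q(p_l)} · Haar_E^{⊗links}` for an additive
Haar measure `Haar_E` of the coordinate space (any two differ by a constant absorbed in `Z`).

* §1 `one_add_pow_le_mul_exp_sq` (`(1+t)^r ≤ 2^r r! e^{t²}`), `exp_neg_sq_le_mul_rpow`;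
  **`lintegral_exp_neg_norm_sq_lt_top`** — `∫ e^{−‖x‖²} dμ < ∞` for an additive Haar measure on a
  finite-dimensional real normed space (comparison with `(1 + ‖x‖)^{−(d+1)}`).
* §2 `sunCoordQuad` (`q`), `sunKinetic N p = Σ_l q(p_l)`: continuous, `≥ 0`, `‖c‖² ≤ q(c)`,
  `q(c) ≤ (N + 4·#pairs) ‖c‖²` (sup norm of the coordinate space), hence bounded on boxes
  (`sunKinetic_le_of_norm_le`); **`sunMomentumWeight_sunKinetic_ne_top`** — `Z_T < ∞`.
* §3 **`engine_sunLeapfrogHMC_uniformlyErgodic`**, **`engine_sunLeapfrogHMC_invariant_unique`** — for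
  every `N ≥ 1`, every finite link set, every `ε > 0`, every measurable force increment bounded by `b`
  and every measurable action bounded by `s` (the Wilson action at any `β` is one): the engine's
  single-step leapfrog HMC kernel `sunLeapfrogHMC (sunCoordι N) _ addHaar (sunKinetic N) ε hg S`
  converges to `Z_S⁻¹ e^{−S} · Haar^{⊗links}` from EVERY initial law at the geometric rate of
  `SUNLeapfrogHMCErgodic.lean`, and that law is its unique invariant probability law.

NOT CLAIMED: `nstep ≥ 2`, OMF words, `tau_jitter`; any usable constant; floating point; the trace
identity `q(c) = −tr (ι c)²` as a Lean statement.
-/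

noncomputable section

namespace Summit.Ventures.LatticeQCDFlow.Exactness

open MeasureTheory ProbabilityTheory ProbabilityTheory.Kernel Set Metric Function NormedSpace Filter Topology
open Literature.MathematicalPhysics.QuantumFieldTheory (haarProbability)
open scoped ENNReal Matrix NNReal Nat

/-! ## §1 A Gaussian tail is integrable against an additive Haar measure -/

section Tail

/-- `(1 + t)^r ≤ 2^r · r! · e^{t²}` for `t ≥ 0`. -/
theorem one_add_pow_le_mul_exp_sq {t : ℝ} (ht : 0 ≤ t) (r : ℕ) :
    (1 + t) ^ r ≤ 2 ^ r * r ! * Real.exp (t ^ 2) := by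
  have hfac : (1 : ℝ) ≤ r ! := by exact_mod_cast Nat.one_le_iff_ne_zero.2 (Nat.factorial_ne_zero r)
  have hexp1 : 1 ≤ Real.exp (t ^ 2) := Real.one_le_exp (sq_nonneg t)
  rcases le_or_gt t 1 with h | h
  · calc (1 + t) ^ r ≤ 2 ^ r := pow_le_pow_left₀ (by positivity) (by linarith) r
      _ = 2 ^ r * 1 * 1 := by ring
      _ ≤ 2 ^ r * r ! * Real.exp (t ^ 2) := by gcongr
  · have h1 : (1 + t) ^ r ≤ (2 * t) ^ r := pow_le_pow_left₀ (by positivity) (by linarith) r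
    have h2 : t ^ r ≤ (t ^ 2) ^ r := by
      rw [← pow_mul]
      exact pow_le_pow_right₀ h.le (by omega)
    have h3 : (t ^ 2) ^ r ≤ r ! * Real.exp (t ^ 2) := by
      have h := Real.pow_div_factorial_le_exp (t ^ 2) (sq_nonneg t) r
      rwa [div_le_iff₀ (by positivity), mul_comm] at h
    calc (1 + t) ^ r ≤ (2 * t) ^ r := h1
      _ = 2 ^ r * t ^ r := mul_pow _ _ _
      _ ≤ 2 ^ r * (r ! * Real.exp (t ^ 2)) := by gcongr; exact h2.trans h3
      _ = 2 ^ r * r ! * Real.exp (t ^ 2) := by ring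

/-- `e^{−t²} ≤ 2^r r! · (1 + t)^{−r}` for `t ≥ 0`. -/
theorem exp_neg_sq_le_mul_rpow {t : ℝ} (ht : 0 ≤ t) (r : ℕ) :
    Real.exp (-t ^ 2) ≤ 2 ^ r * r ! * (1 + t) ^ (-(r : ℝ)) := by
  have hpos : 0 < (1 + t) ^ r := by positivity
  have hexp : 0 < Real.exp (t ^ 2) := Real.exp_pos _
  rw [Real.rpow_neg (by positivity), Real.rpow_natCast, Real.exp_neg]
  have h := one_add_pow_le_mul_exp_sq ht r
  calc (Real.exp (t ^ 2))⁻¹ = (1 + t) ^ r * (((1 + t) ^ r)⁻¹ * (Real.exp (t ^ 2))⁻¹) := by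
        field_simp
    _ ≤ (2 ^ r * r ! * Real.exp (t ^ 2)) * (((1 + t) ^ r)⁻¹ * (Real.exp (t ^ 2))⁻¹) := by gcongr
    _ = 2 ^ r * r ! * ((1 + t) ^ r)⁻¹ := by field_simp

variable {E : Type*} [NormedAddCommGroup E] [NormedSpace ℝ E] [FiniteDimensional ℝ E] [MeasurableSpace E]
  [BorelSpace E] (μ : Measure E) [μ.IsAddHaarMeasure]

/-- **`∫ e^{−‖x‖²} dμ < ∞`** for an additive Haar measure on a finite-dimensional real normed space. -/
theorem lintegral_exp_neg_norm_sq_lt_top : ∫⁻ x, ENNReal.ofReal (Real.exp (-‖x‖ ^ 2)) ∂μ < ⊤ := by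
  set r : ℕ := Module.finrank ℝ E + 1 with hr
  have hrr : (Module.finrank ℝ E : ℝ) < (r : ℝ) := by rw [hr]; exact_mod_cast Nat.lt_succ_self _
  have hfin := finite_integral_one_add_norm (μ := μ) hrr
  have hle : ∀ x : E, ENNReal.ofReal (Real.exp (-‖x‖ ^ 2)) ≤
      ENNReal.ofReal (2 ^ r * r !) * ENNReal.ofReal ((1 + ‖x‖) ^ (-(r : ℝ))) := fun x => by
    rw [← ENNReal.ofReal_mul (by positivity)]
    exact ENNReal.ofReal_le_ofReal (exp_neg_sq_le_mul_rpow (norm_nonneg x) r)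
  calc ∫⁻ x, ENNReal.ofReal (Real.exp (-‖x‖ ^ 2)) ∂μ
      ≤ ∫⁻ x, ENNReal.ofReal (2 ^ r * r !) * ENNReal.ofReal ((1 + ‖x‖) ^ (-(r : ℝ))) ∂μ := lintegral_mono hle
    _ = ENNReal.ofReal (2 ^ r * r !) * ∫⁻ x, ENNReal.ofReal ((1 + ‖x‖) ^ (-(r : ℝ))) ∂μ := by
        rw [lintegral_const_mul]
        exact (by fun_prop : Measurable fun x : E => (1 + ‖x‖) ^ (-(r : ℝ))).ennreal_ofReal
    _ < ⊤ := ENNReal.mul_lt_top ENNReal.ofReal_lt_top hfin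

end Tail

/-! ## §2 The engine's kinetic term in its coordinates -/

section Kinetic

variable (N : ℕ)

/-- **The one-link kinetic quadratic form** `q(d, R, I) = Σ_i d_i² + 2 Σ_{i<j} (R_ij² + I_ij²)`
(`= −tr P²` for `P = ι(d, R, I)`). -/
def sunCoordQuad (c : SUNCoords N) : ℝ :=
  ∑ i, ((c.1 : Fin N → ℝ) i) ^ 2 + 2 * ∑ p, ((c.2.1 p) ^ 2 + (c.2.2 p) ^ 2)

/-- `q` is continuous. -/
theorem continuous_sunCoordQuad : Continuous (sunCoordQuad N) := by
  have h1 : ∀ i : Fin N, Continuous fun c : SUNCoords N => (c.1 : Fin N → ℝ) i := fun i =>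
    (continuous_apply i).comp (continuous_subtype_val.comp continuous_fst)
  have h2 : ∀ p : UpperPair N, Continuous fun c : SUNCoords N => c.2.1 p := fun p =>
    (continuous_apply p).comp (continuous_fst.comp continuous_snd)
  have h3 : ∀ p : UpperPair N, Continuous fun c : SUNCoords N => c.2.2 p := fun p =>
    (continuous_apply p).comp (continuous_snd.comp continuous_snd)
  unfold sunCoordQuad
  exact (continuous_finsetSum _ fun i _ => (h1 i).pow 2).add
    (continuous_const.mul (continuous_finsetSum _ fun p _ => ((h2 p).pow 2).add ((h3 p).pow 2)))

/-- `q ≥ 0`. -/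
theorem sunCoordQuad_nonneg (c : SUNCoords N) : 0 ≤ sunCoordQuad N c := by
  unfold sunCoordQuad; positivity

/-- Each diagonal coordinate is controlled: `d_i² ≤ q`. -/
theorem sq_diag_le_sunCoordQuad (c : SUNCoords N) (i : Fin N) : ((c.1 : Fin N → ℝ) i) ^ 2 ≤ sunCoordQuad N c := by
  unfold sunCoordQuad
  have h1 : ((c.1 : Fin N → ℝ) i) ^ 2 ≤ ∑ j, ((c.1 : Fin N → ℝ) j) ^ 2 :=
    Finset.single_le_sum (f := fun j => ((c.1 : Fin N → ℝ) j) ^ 2) (fun _ _ => sq_nonneg _) (Finset.mem_univ i)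
  have h2 : 0 ≤ 2 * ∑ p, ((c.2.1 p) ^ 2 + (c.2.2 p) ^ 2) := by positivity
  linarith

/-- Each real part is controlled: `R_p² ≤ q`. -/
theorem sq_re_le_sunCoordQuad (c : SUNCoords N) (p : UpperPair N) : (c.2.1 p) ^ 2 ≤ sunCoordQuad N c := by
  unfold sunCoordQuad
  have h1 : (c.2.1 p) ^ 2 + (c.2.2 p) ^ 2 ≤ ∑ p', ((c.2.1 p') ^ 2 + (c.2.2 p') ^ 2) :=
    Finset.single_le_sum (f := fun p' => (c.2.1 p') ^ 2 + (c.2.2 p') ^ 2) (fun _ _ => by positivity) (Finset.mem_univ p)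
  have h2 : 0 ≤ ∑ j, ((c.1 : Fin N → ℝ) j) ^ 2 := by positivity
  nlinarith [sq_nonneg (c.2.2 p), sq_nonneg (c.2.1 p)]

/-- Each imaginary part is controlled: `I_p² ≤ q`. -/
theorem sq_im_le_sunCoordQuad (c : SUNCoords N) (p : UpperPair N) : (c.2.2 p) ^ 2 ≤ sunCoordQuad N c := by
  unfold sunCoordQuad
  have h1 : (c.2.1 p) ^ 2 + (c.2.2 p) ^ 2 ≤ ∑ p', ((c.2.1 p') ^ 2 + (c.2.2 p') ^ 2) :=
    Finset.single_le_sum (f := fun p' => (c.2.1 p') ^ 2 + (c.2.2 p') ^ 2) (fun _ _ => by positivity) (Finset.mem_univ p)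
  have h2 : 0 ≤ ∑ j, ((c.1 : Fin N → ℝ) j) ^ 2 := by positivity
  nlinarith [sq_nonneg (c.2.2 p), sq_nonneg (c.2.1 p)]

/-- **`‖c‖² ≤ q(c)`** (sup norm of the coordinate space). -/
theorem norm_sq_le_sunCoordQuad (c : SUNCoords N) : ‖c‖ ^ 2 ≤ sunCoordQuad N c := by
  have hq := sunCoordQuad_nonneg N c
  suffices h : ‖c‖ ≤ Real.sqrt (sunCoordQuad N c) by
    calc ‖c‖ ^ 2 ≤ Real.sqrt (sunCoordQuad N c) ^ 2 := pow_le_pow_left₀ (norm_nonneg _) h 2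
      _ = sunCoordQuad N c := Real.sq_sqrt hq
  have hcoord : ∀ x : ℝ, x ^ 2 ≤ sunCoordQuad N c → ‖x‖ ≤ Real.sqrt (sunCoordQuad N c) := fun x hx => by
    rw [Real.norm_eq_abs, ← Real.sqrt_sq_eq_abs]
    exact Real.sqrt_le_sqrt hx
  rw [Prod.norm_def, max_le_iff, Prod.norm_def, max_le_iff, Submodule.coe_norm]
  refine ⟨?_, ?_, ?_⟩
  · exact pi_norm_le_iff_of_nonneg (Real.sqrt_nonneg _) |>.2 fun i => hcoord _ (sq_diag_le_sunCoordQuad N c i)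
  · exact pi_norm_le_iff_of_nonneg (Real.sqrt_nonneg _) |>.2 fun p => hcoord _ (sq_re_le_sunCoordQuad N c p)
  · exact pi_norm_le_iff_of_nonneg (Real.sqrt_nonneg _) |>.2 fun p => hcoord _ (sq_im_le_sunCoordQuad N c p)

/-- **`q(c) ≤ (N + 4·#pairs) ‖c‖²`.** -/
theorem sunCoordQuad_le (c : SUNCoords N) :
    sunCoordQuad N c ≤ (N + 4 * Fintype.card (UpperPair N)) * ‖c‖ ^ 2 := by
  have hsq : ∀ x : ℝ, ‖x‖ ≤ ‖c‖ → x ^ 2 ≤ ‖c‖ ^ 2 := fun x hx => by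
    rw [Real.norm_eq_abs] at hx
    calc x ^ 2 = |x| ^ 2 := (sq_abs x).symm
      _ ≤ ‖c‖ ^ 2 := pow_le_pow_left₀ (abs_nonneg _) hx 2
  have hd : ∀ i, ((c.1 : Fin N → ℝ) i) ^ 2 ≤ ‖c‖ ^ 2 := fun i => hsq _ <| by
    calc ‖(c.1 : Fin N → ℝ) i‖ ≤ ‖(c.1 : Fin N → ℝ)‖ := norm_le_pi_norm _ i
      _ = ‖c.1‖ := (Submodule.coe_norm _).symm
      _ ≤ ‖c‖ := norm_fst_le c
  have hR : ∀ p, (c.2.1 p) ^ 2 ≤ ‖c‖ ^ 2 := fun p => hsq _ <| by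
    calc ‖c.2.1 p‖ ≤ ‖c.2.1‖ := norm_le_pi_norm _ p
      _ ≤ ‖c.2‖ := norm_fst_le c.2
      _ ≤ ‖c‖ := norm_snd_le c
  have hI : ∀ p, (c.2.2 p) ^ 2 ≤ ‖c‖ ^ 2 := fun p => hsq _ <| by
    calc ‖c.2.2 p‖ ≤ ‖c.2.2‖ := norm_le_pi_norm _ p
      _ ≤ ‖c.2‖ := norm_snd_le c.2
      _ ≤ ‖c‖ := norm_snd_le c
  unfold sunCoordQuad
  calc ∑ i, ((c.1 : Fin N → ℝ) i) ^ 2 + 2 * ∑ p, ((c.2.1 p) ^ 2 + (c.2.2 p) ^ 2)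
      ≤ ∑ _i : Fin N, ‖c‖ ^ 2 + 2 * ∑ _p : UpperPair N, (‖c‖ ^ 2 + ‖c‖ ^ 2) :=
        add_le_add (Finset.sum_le_sum fun i _ => hd i)
          (mul_le_mul_of_nonneg_left (Finset.sum_le_sum fun p _ => add_le_add (hR p) (hI p)) (by norm_num))
    _ = (N + 4 * Fintype.card (UpperPair N)) * ‖c‖ ^ 2 := by
        rw [Finset.sum_const, Finset.sum_const, Finset.card_univ, Finset.card_univ, Fintype.card_fin,
          nsmul_eq_mul, nsmul_eq_mul]
        ring

variable {L : Type*} [Fintype L]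

/-- **The engine's kinetic term** `T(p) = Σ_l q(p_l)` (`= −Σ_l tr P_l²`). -/
def sunKinetic (p : L → SUNCoords N) : ℝ := ∑ l, sunCoordQuad N (p l)

/-- `T` is continuous. -/
theorem continuous_sunKinetic : Continuous (sunKinetic (L := L) N) :=
  continuous_finsetSum _ fun l _ => (continuous_sunCoordQuad N).comp (continuous_apply l)

/-- `T` is measurable. -/
theorem measurable_sunKinetic : Measurable (sunKinetic (L := L) N) :=
  Finset.measurable_sum _ fun l _ => (continuous_sunCoordQuad N).measurable.comp (measurable_pi_apply l)

/-- `T ≥ 0`. -/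
theorem sunKinetic_nonneg (p : L → SUNCoords N) : 0 ≤ sunKinetic N p :=
  Finset.sum_nonneg fun l _ => sunCoordQuad_nonneg N (p l)

/-- **`T` is bounded on boxes**: `|p_l| ≤ R` for all `l` gives `T(p) ≤ #links · (N + 4·#pairs) · R²`. -/
theorem sunKinetic_le_of_norm_le (R : ℝ) (p : L → SUNCoords N) (hp : ∀ l, ‖p l‖ ≤ R) :
    sunKinetic N p ≤ Fintype.card L * ((N + 4 * Fintype.card (UpperPair N)) * R ^ 2) := by
  unfold sunKinetic
  calc ∑ l, sunCoordQuad N (p l) ≤ ∑ _l : L, (N + 4 * Fintype.card (UpperPair N)) * R ^ 2 := by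
        refine Finset.sum_le_sum fun l _ => (sunCoordQuad_le N (p l)).trans ?_
        exact mul_le_mul_of_nonneg_left (pow_le_pow_left₀ (norm_nonneg _) (hp l) 2) (by positivity)
    _ = Fintype.card L * ((N + 4 * Fintype.card (UpperPair N)) * R ^ 2) := by
        rw [Finset.sum_const, Finset.card_univ, nsmul_eq_mul]

variable (μ : Measure (SUNCoords N)) [μ.IsAddHaarMeasure]

/-- The one-link Gaussian integral is finite: `∫ e^{−q} dμ < ∞`. -/
theorem lintegral_exp_neg_sunCoordQuad_lt_top :
    ∫⁻ c, ENNReal.ofReal (Real.exp (-sunCoordQuad N c)) ∂μ < ⊤ := by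
  refine lt_of_le_of_lt (lintegral_mono fun c => ?_) (lintegral_exp_neg_norm_sq_lt_top μ)
  exact ENNReal.ofReal_le_ofReal (Real.exp_le_exp.2 (by linarith [norm_sq_le_sunCoordQuad N c]))

/-- **`Z_T < ∞`**: the momentum weight of the engine's kinetic term has finite mass
(Tonelli over the links: `Z_T = (∫ e^{−q} dμ)^{#links}`). -/
theorem sunMomentumWeight_sunKinetic_ne_top : sunMomentumWeight (L := L) μ (sunKinetic N) univ ≠ ⊤ := by
  have hmeas1 : Measurable fun c : SUNCoords N => ENNReal.ofReal (Real.exp (-sunCoordQuad N c)) :=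
    (Real.measurable_exp.comp (continuous_sunCoordQuad N).measurable.neg).ennreal_ofReal
  have h1 : ∀ p : L → SUNCoords N, ENNReal.ofReal (Real.exp (-sunKinetic N p)) =
      ∏ l, ENNReal.ofReal (Real.exp (-sunCoordQuad N (p l))) := fun p => by
    rw [← ENNReal.ofReal_prod_of_nonneg (fun l _ => (Real.exp_pos _).le), ← Real.exp_sum]
    congr 1
    rw [sunKinetic, ← Finset.sum_neg_distrib]
  rw [sunMomentumWeight, withDensity_apply _ MeasurableSet.univ, Measure.restrict_univ]
  simp_rw [h1]
  rw [lintegral_prod_pi (fun _ : L => μ) (fun _ => hmeas1), Finset.prod_const, Finset.card_univ]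
  exact ENNReal.pow_ne_top (lintegral_exp_neg_sunCoordQuad_lt_top N μ).ne

end Kinetic

/-! ## §3 The engine's single-step `SU(N)` HMC is uniformly ergodic -/

section Engine

variable (N : ℕ) [NeZero N] {L : Type*} [Fintype L] {ε : ℝ}
  {g : (L → Matrix.specialUnitaryGroup (Fin N) ℂ) → L → SUNCoords N}
  {S : (L → Matrix.specialUnitaryGroup (Fin N) ℂ) → ℝ} {b s : ℝ}

/-- **THE ENGINE'S SINGLE-STEP LEAPFROG HMC ON `SU(N)^links` IS UNIFORMLY ERGODIC.**  For every `N ≥ 1`,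
every finite link set, every step `ε > 0`, every measurable force increment bounded by `b ≥ 0` and every
measurable action bounded by `s`: with the engine's coordinates `sunCoordι N`, kinetic term
`sunKinetic N = −Σ tr P²` and Gaussian refresh `Z⁻¹e^{−T}·addHaar^⊗`, there are `k` and `δ ∈ (0, 1]`
with `|μ₀Kᵗ(A) − π_S(A)| ≤ (1 − δ)^{⌊t/(k+1)⌋}` for EVERY initial law, `π_S = Z_S⁻¹e^{−S}·Haar^{⊗links}`. -/
theorem engine_sunLeapfrogHMC_uniformlyErgodic (hε : 0 < ε) (hg : Measurable g) (hb0 : 0 ≤ b)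
    (hb : ∀ u l, ‖g u l‖ ≤ b) (hS : Measurable S) (hs : ∀ u, |S u| ≤ s) :
    ∃ k : ℕ, ∃ δ : ℝ, 0 < δ ∧ δ ≤ 1 ∧ ∀ (μ₀ : Measure (L → Matrix.specialUnitaryGroup (Fin N) ℂ))
      [IsProbabilityMeasure μ₀] (t : ℕ) (A : Set (L → Matrix.specialUnitaryGroup (Fin N) ℂ)),
      |((fun m : Measure (L → Matrix.specialUnitaryGroup (Fin N) ℂ) =>
            m.bind (sunLeapfrogHMC (sunCoordι N) (sunCoordι_skew N) (Measure.addHaar : Measure (SUNCoords N))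
              (sunKinetic N) ε hg S))^[t] μ₀).real A
          - (gibbsProbability (Measure.pi fun _ : L => haarProbability (Matrix.specialUnitaryGroup (Fin N) ℂ))
              (fun u => Real.exp (-S u))).real A| ≤ (1 - δ) ^ (t / (k + 1)) :=
  sunLeapfrogHMC_uniformlyErgodic (sunCoordι N) (sunCoordι_skew N) Measure.addHaar
    (τ := fun R => Fintype.card L * ((N + 4 * Fintype.card (UpperPair N)) * R ^ 2))
    (sunCoordι_injective N) (sunCoordι_range N) hε (measurable_sunKinetic N) (sunKinetic_nonneg N)
    (sunKinetic_le_of_norm_le N) (sunMomentumWeight_sunKinetic_ne_top N Measure.addHaar) hg hb0 hb hS hs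

/-- **… and `Z_S⁻¹e^{−S}·Haar^{⊗links}` is its ONLY invariant probability law.** -/
theorem engine_sunLeapfrogHMC_invariant_unique (hε : 0 < ε) (hg : Measurable g) (hb0 : 0 ≤ b)
    (hb : ∀ u l, ‖g u l‖ ≤ b) (hS : Measurable S) (hs : ∀ u, |S u| ≤ s)
    {π' : Measure (L → Matrix.specialUnitaryGroup (Fin N) ℂ)} [IsProbabilityMeasure π']
    (hπ' : Invariant (sunLeapfrogHMC (sunCoordι N) (sunCoordι_skew N) (Measure.addHaar : Measure (SUNCoords N))
      (sunKinetic N) ε hg S) π') :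
    π' = gibbsProbability (Measure.pi fun _ : L => haarProbability (Matrix.specialUnitaryGroup (Fin N) ℂ))
      (fun u => Real.exp (-S u)) :=
  sunLeapfrogHMC_invariant_unique (sunCoordι N) (sunCoordι_skew N) Measure.addHaar
    (τ := fun R => Fintype.card L * ((N + 4 * Fintype.card (UpperPair N)) * R ^ 2))
    (sunCoordι_injective N) (sunCoordι_range N) hε (measurable_sunKinetic N) (sunKinetic_nonneg N)
    (sunKinetic_le_of_norm_le N) (sunMomentumWeight_sunKinetic_ne_top N Measure.addHaar) hg hb0 hb hS hs hπ'

end Engine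

end Summit.Ventures.LatticeQCDFlow.Exactness
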